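import Summits.CriticalPhenomena.PercolationContinuityZ3.Theorems.PercNearOneGluingAdditiveGluingKnLemma4Pair
import Summits.CriticalPhenomena.PercolationContinuityZ3.Theorems.PercNearOneGluingAdditiveGluingBlockKernelPairClosure
import Summits.CriticalPhenomena.PercolationContinuityZ3.Theorems.PercNearOneGluingAdditiveGluingBlockGoodThreeRelaysCapture
import Summits.CriticalPhenomena.PercolationContinuityZ3.Theorems.PercNearOneGluingAdditiveGluingBlockGoodThreeRelaysConvex
import Summits.CriticalPhenomena.PercolationContinuityZ3.Theorems.PercNearOneGluingAdditiveGluingBlockGoodThreeRelays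
import Summits.CriticalPhenomena.PercolationContinuityZ3.Theorems.PercNearOneGluingAdditiveGluingLCResidual
import Summits.CriticalPhenomena.PercolationContinuityZ3.Theorems.PercNearOneGluingAdditiveGluingBlockGoodDelMin
import HarnessLib

/-! # Crux `PercNearOneGluing.AdditiveGluing` (stmt-CriticalPhenomena-4576), residual kernel — the structure class
# `residualKernel_two_A4_a0neb` (TTRL V13181) reduced to its irreducible CORE

TTRL deep seat `ttrlatt-v13181-d0`.  Lands `--supports stmt-CriticalPhenomena-4576`; no definitions, no named facts.
V13181 = the residual kernel `hres` of `goodStep_of_residualKernel` for a two-vertex bad block `S`, four relays and `a₀ ≠ b`: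
designated block goodness of the glued bad pair against the PRE-gluing minimiser under drift, with NO induction hypothesis
(so a standalone proof would have to re-derive Kozma–Nitzan-Question-7-type goodness for three relays, cf. the docstring
of `…GoodStepResidualIH.lean`).  This file does not prove it; it pins down formally what is left of it in the present tree.
* `residualKernel_two_threeRelays_of_core`: with the two remaining relays named and ordered, the kernel follows from the
  landed INDUCTION-FREE leaves `blockKernel_pocketFree` (T0), `blockKernel_pair_of_shallow` (T1 = KN Lemma 4),
  `blockGood_threeRelays_doubleHit`, `blockGood_threeRelays_of_captureControl` (both labellings),
  `blockGood_threeRelays_of_convexCapture`, `blockKernel_of_quantLemma5` (Lδ), `blockGood_leaf_delMin` (DM) — unless all of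
  them fail, and then from `hcore`, which receives exactly the failed leaf conditions (strict inequalities).
* `residualKernel_two_A4_a0neb_of_core` (= registered `stub_residualKernelTwoA4OfCore_v13181`): V13181 verbatim from
  `hcore` quantified over all labellings (abbreviated with `let`s; extract `{a₁, a₂} = (A ∖ b) ∖ a₀`, order by reliability).
So the quantified `hcore` is the precise open core of this class: drift, bad pair, glued pair strictly behind `a₀`, deep
gap, positive double-hit mass, capture control failing both ways, non-convex capture, no quantitative-Lemma-5 credit,
deletion drift.  Exact enumeration at `n = 6` (seat lab, 200 sampled drift instances): every instance satisfies at least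
one leaf (the core is empty there; `n = 6` has the single dead pocket `W = S`); `n = 7` census: kit jobs of this seat.
[cite: KozmaNitzan2024, §3.2 (Thms 4–5 pp. 12–14), Lemma 4 (p. 9), Question 7 (p. 36)]
-/

namespace Summit.CriticalPhenomena.PercolationContinuityZ3.Theorems

open MeasureTheory Set
open Literature.Probability.LatticeModels (prodBernoulli)
open Literature.Probability.Percolation (BondConfig openConn openConnIn openGraph)
open scoped BigOperators

section ResidualCore

open Literature.Probability.LatticeModels Literature.Probability.Percolation

variable {n : ℕ}

/-- **The residual kernel at `S.card = 2`, three named relays: reduction to the irreducible core.**  Fix the labelling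
`A = {a₀, a₁, a₂, b}` (four distinct vertices, `μ(a₁ ↔ b) ≤ μ(a₂ ↔ b)`), a two-vertex block `S` disjoint from `A`, the
hypotheses of the residual kernel `hres` of `goodStep_of_residualKernel` (minimiser `a₀`, bad block, drift).  The kernel
inequality follows from the landed induction-free leaves unless ALL of them fail, and in that case from `hcore`, whose
hypotheses are exactly the failed leaf conditions:
(¬T0) the glued block is strictly less reliable than `a₀` (`blockKernel_pocketFree` fails);
(¬T1) the reliability gap to some block vertex exceeds the dead-pocket sum (`blockKernel_pair_of_shallow` fails);
(Dbl) the double hit `{a₀ ∉ K_S ∋ a₁, a₂; a₁ ↔ b; a₂ ↔ b}` has positive mass (`blockGood_threeRelays_doubleHit`);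
(¬CC₁₂, ¬CC₂₁) capture control fails for both labellings (`blockGood_threeRelays_of_captureControl`);
(¬CV) order-convex capture fails (`blockGood_threeRelays_of_convexCapture`);
(¬Lδ) the quantitative-Lemma-5 pocket credit fails at every block vertex (`blockKernel_of_quantLemma5`);
(¬DM) the deletion-minimiser leaf fails: deletion drift or an unreliable outside neighbour in `u − S` (`blockGood_leaf_delMin`).
So `hcore` IS the open core of the structure class `residualKernel_two_A4_a0neb` (TTRL V13181) inside the present tree.
[cite: KozmaNitzan2024, §3.2 (Thms 4–5 pp. 12–14), Lemma 4 (p. 9), Question 7 (p. 36)] -/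
theorem residualKernel_two_threeRelays_of_core (u : Sym2 (Fin n) → unitInterval) (A S : Finset (Fin n))
    (b a₀ a₁ a₂ : Fin n) (sel : Finset (Fin n) → Fin n)
    (hbA : b ∈ A) (ha₀ : a₀ ∈ A) (ha₁ : a₁ ∈ A) (ha₂ : a₂ ∈ A)
    (hA : ∀ a ∈ A, a = a₀ ∨ a = a₁ ∨ a = a₂ ∨ a = b)
    (h0b : a₀ ≠ b) (h1b : a₁ ≠ b) (h2b : a₂ ≠ b) (h01 : a₀ ≠ a₁) (h02 : a₀ ≠ a₂) (h12 : a₁ ≠ a₂)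
    (hSA : Disjoint S A) (hS : S.card = 2) (hsel : ∀ W, sel W ∈ A)
    (hmin : ∀ a ∈ A, (prodBernoulli u).real (openConn a₀ b) ≤ (prodBernoulli u).real (openConn a b))
    (h₁₂ : (prodBernoulli u).real (openConn a₁ b) ≤ (prodBernoulli u).real (openConn a₂ b))
    (hbad : ∀ v ∈ S, (prodBernoulli u).real (openConn v b) < (prodBernoulli u).real (openConn a₀ b))
    (hdrift : ∃ a ∈ A, (prodBernoulli (fun e : Sym2 (Fin n) =>
        if (∀ x ∈ e, x ∈ S) ∧ ¬ e.IsDiag then 1 else u e)).real (openConn a b) <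
      (prodBernoulli (fun e : Sym2 (Fin n) => if (∀ x ∈ e, x ∈ S) ∧ ¬ e.IsDiag then 1 else u e)).real (openConn a₀ b))
    (hcore :
      -- the labelling and the residual-kernel hypotheses, handed on verbatim
      b ∈ A → a₀ ∈ A → a₁ ∈ A → a₂ ∈ A → (∀ a ∈ A, a = a₀ ∨ a = a₁ ∨ a = a₂ ∨ a = b) →
      a₀ ≠ b → a₁ ≠ b → a₂ ≠ b → a₀ ≠ a₁ → a₀ ≠ a₂ → a₁ ≠ a₂ →
      Disjoint S A → S.card = 2 → (∀ W, sel W ∈ A) →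
      (∀ a ∈ A, (prodBernoulli u).real (openConn a₀ b) ≤ (prodBernoulli u).real (openConn a b)) →
      (prodBernoulli u).real (openConn a₁ b) ≤ (prodBernoulli u).real (openConn a₂ b) →
      (∀ v ∈ S, (prodBernoulli u).real (openConn v b) < (prodBernoulli u).real (openConn a₀ b)) →
      (∃ a ∈ A, (prodBernoulli (fun e : Sym2 (Fin n) =>
          if (∀ x ∈ e, x ∈ S) ∧ ¬ e.IsDiag then 1 else u e)).real (openConn a b) <
        (prodBernoulli (fun e : Sym2 (Fin n) => if (∀ x ∈ e, x ∈ S) ∧ ¬ e.IsDiag then 1 else u e)).real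
          (openConn a₀ b)) →
      -- (¬T0) the glued block is strictly behind `a₀`
      (prodBernoulli u).real (⋃ s ∈ S, openConn s b) <
        (prodBernoulli (fun e : Sym2 (Fin n) => if (∀ x ∈ e, x ∈ S) ∧ ¬ e.IsDiag then 1 else u e)).real
          (openConn a₀ b) →
      -- (¬T1) deep bad pair: the gap to some block vertex exceeds the dead-pocket sum
      (∃ s ∈ S, (∑ W ∈ (Finset.univ : Finset (Finset (Fin n))).filter (fun W => Disjoint W A),
          (prodBernoulli u).real {ω : BondConfig (Fin n) | ∀ z : Fin n, (z ∈ W ↔ ω ∈ ⋃ s ∈ S, openConn s z)}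
            * (prodBernoulli u).real (openConnIn ((W : Set (Fin n))ᶜ) (sel W) b)) <
        (prodBernoulli u).real (openConn a₀ b) - (prodBernoulli u).real (openConn s b)) →
      -- (Dbl) the double hit has positive mass
      0 < (prodBernoulli u).real
            ((⋃ s ∈ S, openConn s a₀)ᶜ ∩ (⋃ s ∈ S, openConn s a₁) ∩ (⋃ s ∈ S, openConn s a₂)
              ∩ openConn a₁ b ∩ openConn a₂ b) →
      -- (¬CC₁₂) capture control fails for the labelling `(a₁, a₂)`
      (prodBernoulli u).real ((⋃ s ∈ S, openConn s b) ∩ (⋃ s ∈ S, openConn s a₀)ᶜ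
            ∩ (⋃ s ∈ S, openConn s a₁)ᶜ) <
        (prodBernoulli u).real (openConn a₁ b ∩ (⋃ s ∈ S, openConn s b)ᶜ ∩ (⋃ s ∈ S, openConn s a₂)
            ∩ (⋃ s ∈ S, openConn s a₁)ᶜ ∩ (⋃ s ∈ S, openConn s a₀)ᶜ)
          + ∑ W ∈ (Finset.univ : Finset (Finset (Fin n))).filter (fun W => Disjoint W A),
              max (min ((prodBernoulli u).real ({ω : BondConfig (Fin n) | ∀ z : Fin n, (z ∈ W ↔ ω ∈ ⋃ s ∈ S, openConn s z)}
                          ∩ openConn a₀ b))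
                        ((prodBernoulli u).real ({ω : BondConfig (Fin n) | ∀ z : Fin n, (z ∈ W ↔ ω ∈ ⋃ s ∈ S, openConn s z)}
                          ∩ openConn a₁ b))
                    - (prodBernoulli u).real ({ω : BondConfig (Fin n) | ∀ z : Fin n, (z ∈ W ↔ ω ∈ ⋃ s ∈ S, openConn s z)}
                          ∩ openConn a₂ b)) 0 →
      -- (¬CC₂₁) capture control fails for the labelling `(a₂, a₁)`
      (prodBernoulli u).real ((⋃ s ∈ S, openConn s b) ∩ (⋃ s ∈ S, openConn s a₀)ᶜ
            ∩ (⋃ s ∈ S, openConn s a₂)ᶜ) <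
        (prodBernoulli u).real (openConn a₂ b ∩ (⋃ s ∈ S, openConn s b)ᶜ ∩ (⋃ s ∈ S, openConn s a₁)
            ∩ (⋃ s ∈ S, openConn s a₂)ᶜ ∩ (⋃ s ∈ S, openConn s a₀)ᶜ)
          + ∑ W ∈ (Finset.univ : Finset (Finset (Fin n))).filter (fun W => Disjoint W A),
              max (min ((prodBernoulli u).real ({ω : BondConfig (Fin n) | ∀ z : Fin n, (z ∈ W ↔ ω ∈ ⋃ s ∈ S, openConn s z)}
                          ∩ openConn a₀ b))
                        ((prodBernoulli u).real ({ω : BondConfig (Fin n) | ∀ z : Fin n, (z ∈ W ↔ ω ∈ ⋃ s ∈ S, openConn s z)}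
                          ∩ openConn a₂ b))
                    - (prodBernoulli u).real ({ω : BondConfig (Fin n) | ∀ z : Fin n, (z ∈ W ↔ ω ∈ ⋃ s ∈ S, openConn s z)}
                          ∩ openConn a₁ b)) 0 →
      -- (¬CV) order-convex capture fails
      (prodBernoulli u).real ((⋃ s ∈ S, openConn s b) ∩ (⋃ s ∈ S, openConn s a₀)ᶜ
            ∩ (⋃ s ∈ S, openConn s a₁)ᶜ ∩ (⋃ s ∈ S, openConn s a₂)ᶜ)
          + (prodBernoulli u).real (openConn a₁ b ∩ (⋃ s ∈ S, openConn s b)ᶜ ∩ (⋃ s ∈ S, openConn s a₀)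
            ∩ (⋃ s ∈ S, openConn s a₂) ∩ (⋃ s ∈ S, openConn s a₁)ᶜ) <
        (prodBernoulli u).real ((⋃ s ∈ S, openConn s b) ∩ (⋃ s ∈ S, openConn s a₀)
            ∩ (⋃ s ∈ S, openConn s a₂) ∩ (⋃ s ∈ S, openConn s a₁)ᶜ) →
      -- (¬Lδ) the quantitative-Lemma-5 credit fails at every block vertex
      (∀ v ∈ S, (prodBernoulli u).real (openConn a₀ v)ᶜ ≠ 0 →
        (prodBernoulli u).real (openConn a₀ v)ᶜ
            * (∑ W ∈ (Finset.univ : Finset (Finset (Fin n))).filter (fun W => Disjoint W A),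
                (prodBernoulli u).real {ω : BondConfig (Fin n) | ∀ z : Fin n, (z ∈ W ↔ ω ∈ ⋃ s ∈ S, openConn s z)}
                  * (prodBernoulli u).real (openConnIn ((W : Set (Fin n))ᶜ) (sel W) b)) <
          max ((prodBernoulli u).real (openConn a₀ b) - (prodBernoulli u).real (openConn v b)) 0
            * (prodBernoulli (fun e : Sym2 (Fin n) => if (∀ x ∈ e, x ∈ S) ∧ ¬ e.IsDiag then 1 else u e)).real
                (openConn a₀ v)ᶜ) →
      -- (¬DM) deletion drift, or an outside neighbour of the block that is unreliable in the deleted graph `u − S`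
      ((∃ a ∈ A, (prodBernoulli (fun e : Sym2 (Fin n) => if ∃ y ∈ S, y ∈ e then (0 : unitInterval) else u e)).real
            (openConn a b) <
          (prodBernoulli (fun e : Sym2 (Fin n) => if ∃ y ∈ S, y ∈ e then (0 : unitInterval) else u e)).real
            (openConn a₀ b)) ∨
        (∃ s ∈ S, ∃ z : Fin n, z ∉ S ∧ (u s(s, z) : ℝ) ≠ 0 ∧
          (prodBernoulli (fun e : Sym2 (Fin n) => if ∃ y ∈ S, y ∈ e then (0 : unitInterval) else u e)).real
              (openConn z b) <
            (prodBernoulli (fun e : Sym2 (Fin n) => if ∃ y ∈ S, y ∈ e then (0 : unitInterval) else u e)).real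
              (openConn a₀ b))) →
      (prodBernoulli u).real (openConn a₀ b)
          + (prodBernoulli u).real ((openConn a₀ b)ᶜ ∩ (⋃ s ∈ S, openConn a₀ s) ∩ (⋃ s ∈ S, openConn s b))
        ≤ (prodBernoulli u).real (⋃ s ∈ S, openConn s b)
          + ∑ W ∈ (Finset.univ : Finset (Finset (Fin n))).filter (fun W => Disjoint W A),
              (prodBernoulli u).real {ω : BondConfig (Fin n) | ∀ z : Fin n, (z ∈ W ↔ ω ∈ ⋃ s ∈ S, openConn s z)}
                * (prodBernoulli u).real (openConnIn ((W : Set (Fin n))ᶜ) (sel W) b)) :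
    (prodBernoulli u).real (openConn a₀ b)
        + (prodBernoulli u).real ((openConn a₀ b)ᶜ ∩ (⋃ s ∈ S, openConn a₀ s) ∩ (⋃ s ∈ S, openConn s b))
      ≤ (prodBernoulli u).real (⋃ s ∈ S, openConn s b)
        + ∑ W ∈ (Finset.univ : Finset (Finset (Fin n))).filter (fun W => Disjoint W A),
            (prodBernoulli u).real {ω : BondConfig (Fin n) | ∀ z : Fin n, (z ∈ W ↔ ω ∈ ⋃ s ∈ S, openConn s z)}
              * (prodBernoulli u).real (openConnIn ((W : Set (Fin n))ᶜ) (sel W) b) := by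
  have hSne : S.Nonempty := Finset.card_pos.1 (by omega)
  -- (T0) pocket-free leaf
  by_cases hT0 : (prodBernoulli (fun e : Sym2 (Fin n) => if (∀ x ∈ e, x ∈ S) ∧ ¬ e.IsDiag then 1 else u e)).real
      (openConn a₀ b) ≤ (prodBernoulli u).real (⋃ s ∈ S, openConn s b)
  · exact blockKernel_pocketFree u A S b a₀ sel hT0
  -- (T1) shallow leaf
  by_cases hT1 : ∀ s ∈ S, (prodBernoulli u).real (openConn a₀ b) - (prodBernoulli u).real (openConn s b) ≤
      ∑ W ∈ (Finset.univ : Finset (Finset (Fin n))).filter (fun W => Disjoint W A),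
        (prodBernoulli u).real {ω : BondConfig (Fin n) | ∀ z : Fin n, (z ∈ W ↔ ω ∈ ⋃ s ∈ S, openConn s z)}
          * (prodBernoulli u).real (openConnIn ((W : Set (Fin n))ᶜ) (sel W) b)
  · exact blockKernel_pair_of_shallow u A S b a₀ sel hS hT1
  -- (Dbl) no double hit
  by_cases hDbl : (prodBernoulli u).real
      ((⋃ s ∈ S, openConn s a₀)ᶜ ∩ (⋃ s ∈ S, openConn s a₁) ∩ (⋃ s ∈ S, openConn s a₂)
        ∩ openConn a₁ b ∩ openConn a₂ b) = 0
  · have h := blockGood_threeRelays_doubleHit u A S b a₀ a₁ a₂ sel hbA ha₀ ha₁ ha₂ hA hSne hsel hmin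
    rw [hDbl, add_zero] at h
    exact h
  -- (CC₁₂) capture control, labelling `(a₁, a₂)`
  by_cases hCC12 : (prodBernoulli u).real (openConn a₁ b ∩ (⋃ s ∈ S, openConn s b)ᶜ ∩ (⋃ s ∈ S, openConn s a₂)
          ∩ (⋃ s ∈ S, openConn s a₁)ᶜ ∩ (⋃ s ∈ S, openConn s a₀)ᶜ)
        + ∑ W ∈ (Finset.univ : Finset (Finset (Fin n))).filter (fun W => Disjoint W A),
            max (min ((prodBernoulli u).real ({ω : BondConfig (Fin n) | ∀ z : Fin n, (z ∈ W ↔ ω ∈ ⋃ s ∈ S, openConn s z)}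
                        ∩ openConn a₀ b))
                      ((prodBernoulli u).real ({ω : BondConfig (Fin n) | ∀ z : Fin n, (z ∈ W ↔ ω ∈ ⋃ s ∈ S, openConn s z)}
                        ∩ openConn a₁ b))
                  - (prodBernoulli u).real ({ω : BondConfig (Fin n) | ∀ z : Fin n, (z ∈ W ↔ ω ∈ ⋃ s ∈ S, openConn s z)}
                        ∩ openConn a₂ b)) 0
        ≤ (prodBernoulli u).real ((⋃ s ∈ S, openConn s b) ∩ (⋃ s ∈ S, openConn s a₀)ᶜ
            ∩ (⋃ s ∈ S, openConn s a₁)ᶜ)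
  · exact blockGood_threeRelays_of_captureControl u A S b a₀ a₁ a₂ sel hbA ha₀ ha₁ ha₂ hA hSne hsel hmin hCC12
  -- (CC₂₁) capture control, labelling `(a₂, a₁)`
  have hA' : ∀ a ∈ A, a = a₀ ∨ a = a₂ ∨ a = a₁ ∨ a = b := by
    intro a ha
    rcases hA a ha with h | h | h | h
    · exact Or.inl h
    · exact Or.inr (Or.inr (Or.inl h))
    · exact Or.inr (Or.inl h)
    · exact Or.inr (Or.inr (Or.inr h))
  by_cases hCC21 : (prodBernoulli u).real (openConn a₂ b ∩ (⋃ s ∈ S, openConn s b)ᶜ ∩ (⋃ s ∈ S, openConn s a₁)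
          ∩ (⋃ s ∈ S, openConn s a₂)ᶜ ∩ (⋃ s ∈ S, openConn s a₀)ᶜ)
        + ∑ W ∈ (Finset.univ : Finset (Finset (Fin n))).filter (fun W => Disjoint W A),
            max (min ((prodBernoulli u).real ({ω : BondConfig (Fin n) | ∀ z : Fin n, (z ∈ W ↔ ω ∈ ⋃ s ∈ S, openConn s z)}
                        ∩ openConn a₀ b))
                      ((prodBernoulli u).real ({ω : BondConfig (Fin n) | ∀ z : Fin n, (z ∈ W ↔ ω ∈ ⋃ s ∈ S, openConn s z)}
                        ∩ openConn a₂ b))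
                  - (prodBernoulli u).real ({ω : BondConfig (Fin n) | ∀ z : Fin n, (z ∈ W ↔ ω ∈ ⋃ s ∈ S, openConn s z)}
                        ∩ openConn a₁ b)) 0
        ≤ (prodBernoulli u).real ((⋃ s ∈ S, openConn s b) ∩ (⋃ s ∈ S, openConn s a₀)ᶜ
            ∩ (⋃ s ∈ S, openConn s a₂)ᶜ)
  · exact blockGood_threeRelays_of_captureControl u A S b a₀ a₂ a₁ sel hbA ha₀ ha₂ ha₁ hA' hSne hsel hmin hCC21
  -- (CV) order-convex capture
  by_cases hCV : (prodBernoulli u).real ((⋃ s ∈ S, openConn s b) ∩ (⋃ s ∈ S, openConn s a₀)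
          ∩ (⋃ s ∈ S, openConn s a₂) ∩ (⋃ s ∈ S, openConn s a₁)ᶜ)
        ≤ (prodBernoulli u).real ((⋃ s ∈ S, openConn s b) ∩ (⋃ s ∈ S, openConn s a₀)ᶜ
            ∩ (⋃ s ∈ S, openConn s a₁)ᶜ ∩ (⋃ s ∈ S, openConn s a₂)ᶜ)
          + (prodBernoulli u).real (openConn a₁ b ∩ (⋃ s ∈ S, openConn s b)ᶜ ∩ (⋃ s ∈ S, openConn s a₀)
            ∩ (⋃ s ∈ S, openConn s a₂) ∩ (⋃ s ∈ S, openConn s a₁)ᶜ)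
  · exact blockGood_threeRelays_of_convexCapture u A S b a₀ a₁ a₂ sel hbA ha₀ ha₁ ha₂ hA hSne hsel hmin h₁₂ hCV
  -- (Lδ) the quantitative Lemma 5 leaf at some block vertex
  have hbS : b ∉ S := fun h => Finset.disjoint_left.1 hSA h hbA
  by_cases hLd : ∃ v ∈ S, (prodBernoulli u).real (openConn a₀ v)ᶜ ≠ 0 ∧
      max ((prodBernoulli u).real (openConn a₀ b) - (prodBernoulli u).real (openConn v b)) 0
          * (prodBernoulli (fun e : Sym2 (Fin n) => if (∀ x ∈ e, x ∈ S) ∧ ¬ e.IsDiag then 1 else u e)).real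
              (openConn a₀ v)ᶜ ≤
        (prodBernoulli u).real (openConn a₀ v)ᶜ
          * (∑ W ∈ (Finset.univ : Finset (Finset (Fin n))).filter (fun W => Disjoint W A),
              (prodBernoulli u).real {ω : BondConfig (Fin n) | ∀ z : Fin n, (z ∈ W ↔ ω ∈ ⋃ s ∈ S, openConn s z)}
                * (prodBernoulli u).real (openConnIn ((W : Set (Fin n))ᶜ) (sel W) b))
  · obtain ⟨v, hvS, hN, hpay⟩ := hLd
    exact blockKernel_of_quantLemma5 u A S b a₀ v sel hvS hbS hN hpay
  -- (DM) the deletion-minimiser leaf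
  by_cases hDM : (∀ a ∈ A,
      (prodBernoulli (fun e : Sym2 (Fin n) => if ∃ y ∈ S, y ∈ e then (0 : unitInterval) else u e)).real (openConn a₀ b) ≤
        (prodBernoulli (fun e : Sym2 (Fin n) => if ∃ y ∈ S, y ∈ e then (0 : unitInterval) else u e)).real (openConn a b)) ∧
      (∀ s ∈ S, ∀ z : Fin n, z ∉ S → (u s(s, z) : ℝ) ≠ 0 →
        (prodBernoulli (fun e : Sym2 (Fin n) => if ∃ y ∈ S, y ∈ e then (0 : unitInterval) else u e)).real (openConn a₀ b) ≤
          (prodBernoulli (fun e : Sym2 (Fin n) => if ∃ y ∈ S, y ∈ e then (0 : unitInterval) else u e)).real (openConn z b))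
  · exact blockGood_leaf_delMin u A S b a₀ sel hbA ha₀ hSA hsel hDM.1 hDM.2
  have hLd' : ∀ v ∈ S, (prodBernoulli u).real (openConn a₀ v)ᶜ ≠ 0 →
      (prodBernoulli u).real (openConn a₀ v)ᶜ
          * (∑ W ∈ (Finset.univ : Finset (Finset (Fin n))).filter (fun W => Disjoint W A),
              (prodBernoulli u).real {ω : BondConfig (Fin n) | ∀ z : Fin n, (z ∈ W ↔ ω ∈ ⋃ s ∈ S, openConn s z)}
                * (prodBernoulli u).real (openConnIn ((W : Set (Fin n))ᶜ) (sel W) b)) <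
        max ((prodBernoulli u).real (openConn a₀ b) - (prodBernoulli u).real (openConn v b)) 0
          * (prodBernoulli (fun e : Sym2 (Fin n) => if (∀ x ∈ e, x ∈ S) ∧ ¬ e.IsDiag then 1 else u e)).real
              (openConn a₀ v)ᶜ := by
    intro v hvS hN
    by_contra hle
    exact hLd ⟨v, hvS, hN, not_lt.1 hle⟩
  have hDM' : (∃ a ∈ A,
        (prodBernoulli (fun e : Sym2 (Fin n) => if ∃ y ∈ S, y ∈ e then (0 : unitInterval) else u e)).real (openConn a b) <
          (prodBernoulli (fun e : Sym2 (Fin n) => if ∃ y ∈ S, y ∈ e then (0 : unitInterval) else u e)).real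
            (openConn a₀ b)) ∨
      (∃ s ∈ S, ∃ z : Fin n, z ∉ S ∧ (u s(s, z) : ℝ) ≠ 0 ∧
        (prodBernoulli (fun e : Sym2 (Fin n) => if ∃ y ∈ S, y ∈ e then (0 : unitInterval) else u e)).real (openConn z b) <
          (prodBernoulli (fun e : Sym2 (Fin n) => if ∃ y ∈ S, y ∈ e then (0 : unitInterval) else u e)).real
            (openConn a₀ b)) := by
    by_cases hP : ∀ a ∈ A,
        (prodBernoulli (fun e : Sym2 (Fin n) => if ∃ y ∈ S, y ∈ e then (0 : unitInterval) else u e)).real (openConn a₀ b) ≤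
          (prodBernoulli (fun e : Sym2 (Fin n) => if ∃ y ∈ S, y ∈ e then (0 : unitInterval) else u e)).real (openConn a b)
    · right
      by_contra hQ
      refine hDM ⟨hP, ?_⟩
      intro s hs z hz hne
      by_contra hlt
      exact hQ ⟨s, hs, z, hz, hne, not_le.1 hlt⟩
    · left
      by_contra hQ
      refine hP ?_
      intro a ha
      by_contra hlt
      exact hQ ⟨a, ha, not_le.1 hlt⟩
  -- the core
  push Not at hT0 hT1 hCC12 hCC21 hCV
  exact hcore hbA ha₀ ha₁ ha₂ hA h0b h1b h2b h01 h02 h12 hSA hS hsel hmin h₁₂ hbad hdrift hT0 hT1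
    (lt_of_le_of_ne measureReal_nonneg (Ne.symm hDbl)) hCC12 hCC21 hCV hLd' hDM'

/-- **Structure class `residualKernel_two_A4_a0neb` (TTRL V13181) from its irreducible core.**  The residual kernel
`hres` of `goodStep_of_residualKernel` restricted to `S.card = 2`, `A.card = 4`, `a₀ ≠ b` — verbatim the TTRL variant
V13181 of stmt-CriticalPhenomena-4576 — follows from `hcore`: the same statement with the two remaining relays named
(`A = {a₀, a₁, a₂, b}`, `μ(a₁ ↔ b) ≤ μ(a₂ ↔ b)`) and with the extra hypotheses that every induction-free leaf in the tree
fails (see `residualKernel_two_threeRelays_of_core`).  `hcore` is therefore the precise next target for this class; its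
point-observer shadow is Kozma–Nitzan's Question 7 with three relays in the non-convex-capture / double-hit regime.
[cite: KozmaNitzan2024, §3.2 (Thms 4–5 pp. 12–14), Question 7 (p. 36)] -/
theorem residualKernel_two_A4_a0neb_of_core
    (hcore : ∀ (n : ℕ) (u : Sym2 (Fin n) → unitInterval) (A S : Finset (Fin n)) (b a₀ a₁ a₂ : Fin n)
      (sel : Finset (Fin n) → Fin n),
      let μ := prodBernoulli u
      let μg := prodBernoulli (fun e : Sym2 (Fin n) => if (∀ x ∈ e, x ∈ S) ∧ ¬ e.IsDiag then 1 else u e)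
      let μd := prodBernoulli (fun e : Sym2 (Fin n) => if ∃ y ∈ S, y ∈ e then (0 : unitInterval) else u e)
      let KW := fun W : Finset (Fin n) => {ω : BondConfig (Fin n) | ∀ z : Fin n, (z ∈ W ↔ ω ∈ ⋃ s ∈ S, openConn s z)}
      let P := ∑ W ∈ (Finset.univ : Finset (Finset (Fin n))).filter (fun W => Disjoint W A),
        μ.real (KW W) * μ.real (openConnIn ((W : Set (Fin n))ᶜ) (sel W) b)
      let Y := ⋃ s ∈ S, openConn s b
      let X₀ := ⋃ s ∈ S, openConn s a₀
      let X₁ := ⋃ s ∈ S, openConn s a₁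
      let X₂ := ⋃ s ∈ S, openConn s a₂
      -- labelling and residual-kernel hypotheses (minimiser, order, bad block, drift)
      b ∈ A → a₀ ∈ A → a₁ ∈ A → a₂ ∈ A → (∀ a ∈ A, a = a₀ ∨ a = a₁ ∨ a = a₂ ∨ a = b) →
      a₀ ≠ b → a₁ ≠ b → a₂ ≠ b → a₀ ≠ a₁ → a₀ ≠ a₂ → a₁ ≠ a₂ → Disjoint S A → S.card = 2 → (∀ W, sel W ∈ A) →
      (∀ a ∈ A, μ.real (openConn a₀ b) ≤ μ.real (openConn a b)) → μ.real (openConn a₁ b) ≤ μ.real (openConn a₂ b) →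
      (∀ v ∈ S, μ.real (openConn v b) < μ.real (openConn a₀ b)) →
      (∃ a ∈ A, μg.real (openConn a b) < μg.real (openConn a₀ b)) →
      -- (¬T0) glued pair strictly behind `a₀`;  (¬T1) deep gap;  (Dbl) positive double-hit mass
      μ.real Y < μg.real (openConn a₀ b) →
      (∃ s ∈ S, P < μ.real (openConn a₀ b) - μ.real (openConn s b)) →
      0 < μ.real (X₀ᶜ ∩ X₁ ∩ X₂ ∩ openConn a₁ b ∩ openConn a₂ b) →
      -- (¬CC₁₂), (¬CC₂₁) capture control fails both ways;  (¬CV) non-convex capture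
      μ.real (Y ∩ X₀ᶜ ∩ X₁ᶜ) < μ.real (openConn a₁ b ∩ Yᶜ ∩ X₂ ∩ X₁ᶜ ∩ X₀ᶜ)
          + ∑ W ∈ (Finset.univ : Finset (Finset (Fin n))).filter (fun W => Disjoint W A),
              max (min (μ.real (KW W ∩ openConn a₀ b)) (μ.real (KW W ∩ openConn a₁ b)) - μ.real (KW W ∩ openConn a₂ b)) 0 →
      μ.real (Y ∩ X₀ᶜ ∩ X₂ᶜ) < μ.real (openConn a₂ b ∩ Yᶜ ∩ X₁ ∩ X₂ᶜ ∩ X₀ᶜ)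
          + ∑ W ∈ (Finset.univ : Finset (Finset (Fin n))).filter (fun W => Disjoint W A),
              max (min (μ.real (KW W ∩ openConn a₀ b)) (μ.real (KW W ∩ openConn a₂ b)) - μ.real (KW W ∩ openConn a₁ b)) 0 →
      μ.real (Y ∩ X₀ᶜ ∩ X₁ᶜ ∩ X₂ᶜ) + μ.real (openConn a₁ b ∩ Yᶜ ∩ X₀ ∩ X₂ ∩ X₁ᶜ) < μ.real (Y ∩ X₀ ∩ X₂ ∩ X₁ᶜ) →
      -- (¬Lδ) no quantitative-Lemma-5 credit;  (¬DM) deletion drift or an unreliable outside neighbour in `u − S`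
      (∀ v ∈ S, μ.real (openConn a₀ v)ᶜ ≠ 0 →
        μ.real (openConn a₀ v)ᶜ * P < max (μ.real (openConn a₀ b) - μ.real (openConn v b)) 0 * μg.real (openConn a₀ v)ᶜ) →
      ((∃ a ∈ A, μd.real (openConn a b) < μd.real (openConn a₀ b)) ∨
        (∃ s ∈ S, ∃ z : Fin n, z ∉ S ∧ (u s(s, z) : ℝ) ≠ 0 ∧ μd.real (openConn z b) < μd.real (openConn a₀ b))) →
      μ.real (openConn a₀ b) + μ.real ((openConn a₀ b)ᶜ ∩ (⋃ s ∈ S, openConn a₀ s) ∩ Y) ≤ μ.real Y + P) :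
    ∀ (n : ℕ) (u : Sym2 (Fin n) → unitInterval) (A S : Finset (Fin n)) (b a₀ : Fin n) (sel : Finset (Fin n) → Fin n),
      b ∈ A → Disjoint S A → S.card = 2 → A.card = 4 → (∀ W, sel W ∈ A) → a₀ ∈ A → a₀ ≠ b →
      (∀ a ∈ A, (prodBernoulli u).real (openConn a₀ b) ≤ (prodBernoulli u).real (openConn a b)) →
      (∀ v ∈ S, (prodBernoulli u).real (openConn v b) < (prodBernoulli u).real (openConn a₀ b)) →
      (∃ a ∈ A, (prodBernoulli (fun e : Sym2 (Fin n) => if (∀ x ∈ e, x ∈ S) ∧ ¬ e.IsDiag then 1 else u e)).real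
          (openConn a b) <
        (prodBernoulli (fun e : Sym2 (Fin n) => if (∀ x ∈ e, x ∈ S) ∧ ¬ e.IsDiag then 1 else u e)).real
          (openConn a₀ b)) →
      (prodBernoulli u).real (openConn a₀ b)
          + (prodBernoulli u).real ((openConn a₀ b)ᶜ ∩ (⋃ s ∈ S, openConn a₀ s) ∩ (⋃ s ∈ S, openConn s b))
        ≤ (prodBernoulli u).real (⋃ s ∈ S, openConn s b)
          + ∑ W ∈ (Finset.univ : Finset (Finset (Fin n))).filter (fun W => Disjoint W A),
              (prodBernoulli u).real {ω : BondConfig (Fin n) | ∀ z : Fin n, (z ∈ W ↔ ω ∈ ⋃ s ∈ S, openConn s z)}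
                * (prodBernoulli u).real (openConnIn ((W : Set (Fin n))ᶜ) (sel W) b) := by
  intro n u A S b a₀ sel hbA hSA hS hA4 hsel ha₀ h0b hmin hbad hdrift
  -- name the two relays besides `a₀` and `b`
  have hcard : ((A.erase b).erase a₀).card = 2 := by
    rw [Finset.card_erase_of_mem (Finset.mem_erase.2 ⟨h0b, ha₀⟩), Finset.card_erase_of_mem hbA, hA4]
  obtain ⟨x, y, hxy, hxyeq⟩ := Finset.card_eq_two.1 hcard
  have hx : x ∈ (A.erase b).erase a₀ := by rw [hxyeq]; exact Finset.mem_insert_self x {y}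
  have hy : y ∈ (A.erase b).erase a₀ := by rw [hxyeq]; exact Finset.mem_insert_of_mem (Finset.mem_singleton_self y)
  simp only [Finset.mem_erase] at hx hy
  obtain ⟨hx0, hxb, hxA⟩ := hx
  obtain ⟨hy0, hyb, hyA⟩ := hy
  have hA : ∀ a ∈ A, a = a₀ ∨ a = x ∨ a = y ∨ a = b := by
    intro a ha
    by_cases h1 : a = b
    · exact Or.inr (Or.inr (Or.inr h1))
    by_cases h2 : a = a₀
    · exact Or.inl h2
    have ha' : a ∈ (A.erase b).erase a₀ := Finset.mem_erase.2 ⟨h2, Finset.mem_erase.2 ⟨h1, ha⟩⟩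
    rw [hxyeq, Finset.mem_insert, Finset.mem_singleton] at ha'
    rcases ha' with h | h
    · exact Or.inr (Or.inl h)
    · exact Or.inr (Or.inr (Or.inl h))
  have hA' : ∀ a ∈ A, a = a₀ ∨ a = y ∨ a = x ∨ a = b := by
    intro a ha
    rcases hA a ha with h | h | h | h
    · exact Or.inl h
    · exact Or.inr (Or.inr (Or.inl h))
    · exact Or.inr (Or.inl h)
    · exact Or.inr (Or.inr (Or.inr h))
  -- order the two relays by reliability
  rcases le_total ((prodBernoulli u).real (openConn x b)) ((prodBernoulli u).real (openConn y b)) with hle | hle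
  · exact residualKernel_two_threeRelays_of_core u A S b a₀ x y sel hbA ha₀ hxA hyA hA h0b hxb hyb
      (Ne.symm hx0) (Ne.symm hy0) hxy hSA hS hsel hmin hle hbad hdrift (hcore n u A S b a₀ x y sel)
  · exact residualKernel_two_threeRelays_of_core u A S b a₀ y x sel hbA ha₀ hyA hxA hA' h0b hyb hxb
      (Ne.symm hy0) (Ne.symm hx0) (Ne.symm hxy) hSA hS hsel hmin hle hbad hdrift (hcore n u A S b a₀ y x sel)

end ResidualCore

open Literature.Probability.LatticeModels Literature.Probability.Percolation in
/-- Registered helper stub `stub_residualKernelTwoA4OfCore_v13181` (TTRL deep seat V13181): the structure class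
`residualKernel_two_A4_a0neb` of the residual kernel from its irreducible core, verbatim
`residualKernel_two_A4_a0neb_of_core` in closed form. [cite: KozmaNitzan2024, §3.2 (Thms 4–5 pp. 12–14), Question 7 (p. 36)] -/
theorem stub_residualKernelTwoA4OfCore_v13181 : (∀ (n : ℕ) (u : Sym2 (Fin n) → unitInterval) (A S : Finset (Fin n)) (b a₀ a₁ a₂ : Fin n) (sel : Finset (Fin n) → Fin n), let μ := prodBernoulli u; let μg := prodBernoulli (fun e : Sym2 (Fin n) => if (∀ x ∈ e, x ∈ S) ∧ ¬ e.IsDiag then 1 else u e); let μd := prodBernoulli (fun e : Sym2 (Fin n) => if ∃ y ∈ S, y ∈ e then (0 : unitInterval) else u e); let KW := fun W : Finset (Fin n) => {ω : BondConfig (Fin n) | ∀ z : Fin n, (z ∈ W ↔ ω ∈ ⋃ s ∈ S, openConn s z)}; let P := ∑ W ∈ (Finset.univ : Finset (Finset (Fin n))).filter (fun W => Disjoint W A), μ.real (KW W) * μ.real (openConnIn ((W : Set (Fin n))ᶜ) (sel W) b); let Y := ⋃ s ∈ S, openConn s b; let X₀ := ⋃ s ∈ S, openConn s a₀; let X₁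 := ⋃ s ∈ S, openConn s a₁; let X₂ := ⋃ s ∈ S, openConn s a₂; b ∈ A → a₀ ∈ A → a₁ ∈ A → a₂ ∈ A → (∀ a ∈ A, a = a₀ ∨ a = a₁ ∨ a = a₂ ∨ a = b) → a₀ ≠ b → a₁ ≠ b → a₂ ≠ b → a₀ ≠ a₁ → a₀ ≠ a₂ → a₁ ≠ a₂ → Disjoint S A → S.card = 2 → (∀ W, sel W ∈ A) → (∀ a ∈ A, μ.real (openConn a₀ b) ≤ μ.real (openConn a b)) → μ.real (openConn a₁ b) ≤ μ.real (openConn a₂ b) → (∀ v ∈ S, μ.real (openConn v b) < μ.real (openConn a₀ b)) → (∃ a ∈ A, μg.real (openConn a b) < μg.real (openConn a₀ b)) → μ.real Y < μg.real (openConn a₀ b) → (∃ s ∈ S, P < μ.real (openConn a₀ b) - μ.real (openConn s b)) → 0 < μ.real (X₀ᶜ ∩ X₁ ∩ X₂ ∩ openConn a₁ b ∩ openConn a₂ b) → μ.real (Y ∩ X₀ᶜ ∩ X₁ᶜ) < μ.real (openConn a₁ b ∩ Yᶜ ∩ X₂ ∩ X₁ᶜ ∩ X₀ᶜ) + ∑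 W ∈ (Finset.univ : Finset (Finset (Fin n))).filter (fun W => Disjoint W A), max (min (μ.real (KW W ∩ openConn a₀ b)) (μ.real (KW W ∩ openConn a₁ b)) - μ.real (KW W ∩ openConn a₂ b)) 0 → μ.real (Y ∩ X₀ᶜ ∩ X₂ᶜ) < μ.real (openConn a₂ b ∩ Yᶜ ∩ X₁ ∩ X₂ᶜ ∩ X₀ᶜ) + ∑ W ∈ (Finset.univ : Finset (Finset (Fin n))).filter (fun W => Disjoint W A), max (min (μ.real (KW W ∩ openConn a₀ b)) (μ.real (KW W ∩ openConn a₂ b)) - μ.real (KW W ∩ openConn a₁ b)) 0 → μ.real (Y ∩ X₀ᶜ ∩ X₁ᶜ ∩ X₂ᶜ) + μ.real (openConn a₁ b ∩ Yᶜ ∩ X₀ ∩ X₂ ∩ X₁ᶜ) < μ.real (Y ∩ X₀ ∩ X₂ ∩ X₁ᶜ) → (∀ v ∈ S, μ.real (openConn a₀ v)ᶜ ≠ 0 → μ.real (openConn a₀ v)ᶜ * P < max (μ.real (openConn a₀ b) - μ.real (openConn v b)) 0 * μg.real (openConn a₀ v)ᶜ) → ((∃ a ∈ A, μd.real (openConn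 a b) < μd.real (openConn a₀ b)) ∨ (∃ s ∈ S, ∃ z : Fin n, z ∉ S ∧ (u s(s, z) : ℝ) ≠ 0 ∧ μd.real (openConn z b) < μd.real (openConn a₀ b))) → μ.real (openConn a₀ b) + μ.real ((openConn a₀ b)ᶜ ∩ (⋃ s ∈ S, openConn a₀ s) ∩ Y) ≤ μ.real Y + P) → ∀ (n : ℕ) (u : Sym2 (Fin n) → unitInterval) (A S : Finset (Fin n)) (b a₀ : Fin n) (sel : Finset (Fin n) → Fin n), b ∈ A → Disjoint S A → S.card = 2 → A.card = 4 → (∀ W, sel W ∈ A) → a₀ ∈ A → a₀ ≠ b → (∀ a ∈ A, (prodBernoulli u).real (openConn a₀ b) ≤ (prodBernoulli u).real (openConn a b)) → (∀ v ∈ S, (prodBernoulli u).real (openConn v b) < (prodBernoulli u).real (openConn a₀ b)) → (∃ a ∈ A, (prodBernoulli (fun e : Sym2 (Fin n) => if (∀ x ∈ e, x ∈ S) ∧ ¬ e.IsDiag then 1 else u e)).real (openConn a b) < (prodBernoulli (fun e : Sym2 (Fin n) => if (∀ x ∈ e, x ∈ S) ∧ ¬ e.IsDiag then 1 else u e)).real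 (openConn a₀ b)) → (prodBernoulli u).real (openConn a₀ b) + (prodBernoulli u).real ((openConn a₀ b)ᶜ ∩ (⋃ s ∈ S, openConn a₀ s) ∩ (⋃ s ∈ S, openConn s b)) ≤ (prodBernoulli u).real (⋃ s ∈ S, openConn s b) + ∑ W ∈ (Finset.univ : Finset (Finset (Fin n))).filter (fun W => Disjoint W A), (prodBernoulli u).real {ω : BondConfig (Fin n) | ∀ z : Fin n, (z ∈ W ↔ ω ∈ ⋃ s ∈ S, openConn s z)} * (prodBernoulli u).real (openConnIn ((W : Set (Fin n))ᶜ) (sel W) b) :=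
  residualKernel_two_A4_a0neb_of_core

end Summit.CriticalPhenomena.PercolationContinuityZ3.Theorems
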